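import Summits.RiemannHypothesis.RiemannHypothesis.Theorems.PfPersistenceRatioIndexReading
import HarnessLib

/-!
# PF persistence — DEGENERATE WINDOWS (`N = 0`) and the GUARDED ∀-window ratio classes (pub-rhpf barrier-prover,
gen 5; re-typing required by RULING A324 on GAP-CLASSES G1.21b-RATIO-AW)

**HONEST FRAMING. Mechanism / rigidity campaign; no RH claims.** RH-free, sorry-free, no numerical datum used.

`Window` admits `N = 0`. There the block is `1 × 1` with entry `m`, `ε₁ = m`, and `ε₂ = max(m, 0)` (the `u ≠ 0`
branch of the Courant–Fischer supremum is the junk value `sInf ∅ = 0`), so the gauge is `max(0, −m)` and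
membership in `gaugeRatioAt τ ⟨a, 0⟩` (`τ < 1`) or `modulusRatioAt κ ⟨a, 0⟩` (`κ < 1`) FORCES `m = 0`. Hence the
UNGUARDED classes `GaugeRatioClass τ` / `ModulusRatioClass κ` of `PfPersistenceRatioRejection` /
`…ModulusIsolation` reject every datum with a non-zero degenerate entry — the recorded reason (RULING A324 (3)(c))
for re-typing the `(Z)`-cell's ∀-window half over windows of dimension `≥ 2`:

* §1 (PROVED) `bottomRayleigh_fin_one`, `secondRayleigh_fin_one` (`= max (M 0 0) 0`), `mem_gaugeRatioClass_N0` /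
  `mem_modulusRatioClass_N0` (membership ⇒ `(d ⟨a, 0⟩) 0 0 = 0` for every `a`), and the emptiness of the unguarded
  cell modulo ONE sign: `(ζ ⟨a, 0⟩) 0 0 ≠ 0` at a single `a` already bars every `S ⊆ GaugeRatioClass τ` from
  separating `ζ` (that sign is DATA, not proved here);
* §2 (DEFINITIONS) the GUARDED classes `GaugeRatioClassPos τ := {d | ∀ win, 0 < win.N → d ∈ gaugeRatioAt τ win}`,
  `ModulusRatioClassPos κ` likewise, with the inclusions from the unguarded ones; the guarded isolation theorems and
  zero-side readings are re-run in `PfPersistenceRatioGuardedIsolation`.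
-/

set_option linter.dupNamespace false

noncomputable section

open Real Set Matrix

namespace Summit.RiemannHypothesis.RiemannHypothesis.Theorems.PfPersistence

/-! ## §1 The `1 × 1` window: `ε₁ = m`, `ε₂ = max(m, 0)`, and the forced zero entry -/

/-- PROVED: dot product on `Fin 1`. [folklore] -/
theorem dotProduct_fin_one (v w : Fin 1 → ℝ) : v ⬝ᵥ w = v 0 * w 0 := by
  simp [dotProduct]

/-- PROVED: the quadratic form of a `1 × 1` matrix. [folklore] -/
theorem form_fin_one (M : Matrix (Fin 1) (Fin 1) ℝ) (v : Fin 1 → ℝ) : v ⬝ᵥ (M *ᵥ v) = M 0 0 * (v 0 * v 0) := by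
  simp [dotProduct, Matrix.mulVec]
  ring

/-- PROVED: a vector on `Fin 1` is non-zero iff its entry is. [folklore] -/
theorem fin_one_ne_zero_iff {v : Fin 1 → ℝ} : v ≠ 0 ↔ v 0 ≠ 0 := by
  constructor
  · intro hv h0
    apply hv
    funext i
    fin_cases i
    simpa using h0
  · intro h0 hv
    exact h0 (by simp [hv])

/-- PROVED: every Rayleigh quotient of a `1 × 1` matrix is its entry. [folklore] -/
theorem rayleigh_fin_one (M : Matrix (Fin 1) (Fin 1) ℝ) {v : Fin 1 → ℝ} (hv : v ≠ 0) :
    v ⬝ᵥ (M *ᵥ v) / (v ⬝ᵥ v) = M 0 0 := by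
  have h0 : v 0 ≠ 0 := fin_one_ne_zero_iff.1 hv
  rw [form_fin_one, dotProduct_fin_one, mul_div_assoc, div_self (mul_ne_zero h0 h0), mul_one]

/-- PROVED: the Rayleigh set of a `1 × 1` matrix is the singleton of its entry. [folklore] -/
theorem rayleighSet_fin_one (M : Matrix (Fin 1) (Fin 1) ℝ) :
    {r : ℝ | ∃ v : Fin 1 → ℝ, v ≠ 0 ∧ r = v ⬝ᵥ (M *ᵥ v) / (v ⬝ᵥ v)} = {M 0 0} := by
  have h1 : (fun _ : Fin 1 => (1 : ℝ)) ≠ 0 := fin_one_ne_zero_iff.2 (by norm_num)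
  ext r
  simp only [mem_setOf_eq, mem_singleton_iff]
  constructor
  · rintro ⟨v, hv, rfl⟩
    exact rayleigh_fin_one M hv
  · intro hr
    exact ⟨fun _ => 1, h1, by rw [rayleigh_fin_one M h1, hr]⟩

/-- **PROVED — `ε₁ = m` on a `1 × 1` window.** [folklore] -/
theorem bottomRayleigh_fin_one (M : Matrix (Fin 1) (Fin 1) ℝ) : bottomRayleigh M = M 0 0 := by
  rw [bottomRayleigh, rayleighSet_fin_one, csInf_singleton]

/-- PROVED: the constrained Rayleigh set for the constraint `u = 0` is again the singleton. [folklore] -/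
theorem orthRayleighSet_fin_one_zero (M : Matrix (Fin 1) (Fin 1) ℝ) :
    {r : ℝ | ∃ v : Fin 1 → ℝ, v ≠ 0 ∧ v ⬝ᵥ (0 : Fin 1 → ℝ) = 0 ∧ r = v ⬝ᵥ (M *ᵥ v) / (v ⬝ᵥ v)} = {M 0 0} := by
  rw [← rayleighSet_fin_one M]
  ext r
  simp only [mem_setOf_eq, dotProduct_zero, true_and]

/-- PROVED: for a non-zero constraint `u` on `Fin 1` the constrained Rayleigh set is EMPTY (`u^⊥ = 0`). [folklore] -/
theorem orthRayleighSet_fin_one_empty (M : Matrix (Fin 1) (Fin 1) ℝ) {u : Fin 1 → ℝ} (hu : u ≠ 0) :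
    {r : ℝ | ∃ v : Fin 1 → ℝ, v ≠ 0 ∧ v ⬝ᵥ u = 0 ∧ r = v ⬝ᵥ (M *ᵥ v) / (v ⬝ᵥ v)} = ∅ := by
  ext r
  simp only [mem_setOf_eq, mem_empty_iff_false, iff_false]
  rintro ⟨v, hv, hvu, -⟩
  rw [dotProduct_fin_one] at hvu
  exact mul_ne_zero (fin_one_ne_zero_iff.1 hv) (fin_one_ne_zero_iff.1 hu) hvu

/-- **PROVED — `ε₂ = max(m, 0)` on a `1 × 1` window** (the `u ≠ 0` branch contributes the junk `sInf ∅ = 0`).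
[folklore] -/
theorem secondRayleigh_fin_one (M : Matrix (Fin 1) (Fin 1) ℝ) : secondRayleigh M = max (M 0 0) 0 := by
  have hval : ∀ u : Fin 1 → ℝ,
      sInf {r : ℝ | ∃ v : Fin 1 → ℝ, v ≠ 0 ∧ v ⬝ᵥ u = 0 ∧ r = v ⬝ᵥ (M *ᵥ v) / (v ⬝ᵥ v)}
        = if u = 0 then M 0 0 else 0 := by
    intro u
    split_ifs with hu
    · rw [hu, orthRayleighSet_fin_one_zero, csInf_singleton]
    · rw [orthRayleighSet_fin_one_empty M hu, Real.sInf_empty]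
  have hfun : (fun u : Fin 1 → ℝ =>
      sInf {r : ℝ | ∃ v : Fin 1 → ℝ, v ≠ 0 ∧ v ⬝ᵥ u = 0 ∧ r = v ⬝ᵥ (M *ᵥ v) / (v ⬝ᵥ v)})
        = fun u => if u = 0 then M 0 0 else 0 := funext hval
  have h1 : (fun _ : Fin 1 => (1 : ℝ)) ≠ 0 := fin_one_ne_zero_iff.2 (by norm_num)
  have hbdd : BddAbove (Set.range fun u : Fin 1 → ℝ => if u = 0 then M 0 0 else (0 : ℝ)) := by
    refine ⟨max (M 0 0) 0, ?_⟩
    rintro _ ⟨u, rfl⟩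
    dsimp only
    split_ifs
    · exact le_max_left _ _
    · exact le_max_right _ _
  unfold secondRayleigh
  rw [hfun]
  apply le_antisymm
  · refine ciSup_le fun u => ?_
    split_ifs
    · exact le_max_left _ _
    · exact le_max_right _ _
  · apply max_le
    · simpa using le_ciSup hbdd 0
    · simpa [h1] using le_ciSup hbdd (fun _ => 1)

/-- **PROVED — on a `1 × 1` window the gauge-ratio bound (`τ < 1`) FORCES `m = 0`.** [folklore] -/
theorem entry_eq_zero_of_gaugeRatio_fin_one {M : Matrix (Fin 1) (Fin 1) ℝ} {τ : ℝ} (hτ : τ < 1)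
    (h : |bottomRayleigh M| ≤ τ * (secondRayleigh M - bottomRayleigh M)) : M 0 0 = 0 := by
  rw [bottomRayleigh_fin_one, secondRayleigh_fin_one] at h
  by_cases hm : M 0 0 ≤ 0
  · rw [max_eq_right hm, abs_of_nonpos hm] at h
    have h1 : (1 - τ) * (-(M 0 0)) ≤ (1 - τ) * 0 := by nlinarith
    have h2 := le_of_mul_le_mul_left h1 (by linarith)
    linarith
  · have hpos : 0 < M 0 0 := not_le.1 hm
    rw [max_eq_left hpos.le, abs_of_pos hpos] at h
    linarith

/-- **PROVED — on a `1 × 1` window the modulus-ratio bound (`κ < 1`) FORCES `m = 0`.** [folklore] -/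
theorem entry_eq_zero_of_modulusRatio_fin_one {M : Matrix (Fin 1) (Fin 1) ℝ} {κ : ℝ} (hκ : κ < 1)
    (h : |bottomRayleigh M| ≤ κ * |secondRayleigh M|) : M 0 0 = 0 := by
  rw [bottomRayleigh_fin_one, secondRayleigh_fin_one] at h
  by_cases hm : M 0 0 ≤ 0
  · rw [max_eq_right hm, abs_zero, mul_zero] at h
    exact abs_nonpos_iff.1 h
  · have hpos : 0 < M 0 0 := not_le.1 hm
    rw [max_eq_left hpos.le, abs_of_pos hpos] at h
    have h1 : (1 - κ) * M 0 0 ≤ (1 - κ) * 0 := by nlinarith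
    exact absurd (le_of_mul_le_mul_left h1 (by linarith)) hm

/-- PROVED (datum form): membership in `gaugeRatioAt τ ⟨a, 0⟩` (`τ < 1`) forces the degenerate entry to vanish.
[folklore] -/
theorem entry_eq_zero_of_mem_gaugeRatioAt_N0 {d : Datum} {a : ℝ} (ha : 0 < a) {τ : ℝ} (hτ : τ < 1)
    (h : d ∈ gaugeRatioAt τ ⟨a, 0, ha⟩) : d ⟨a, 0, ha⟩ 0 0 = 0 :=
  entry_eq_zero_of_gaugeRatio_fin_one (M := d ⟨a, 0, ha⟩) hτ h

/-- PROVED (datum form, modulus). [folklore] -/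
theorem entry_eq_zero_of_mem_modulusRatioAt_N0 {d : Datum} {a : ℝ} (ha : 0 < a) {κ : ℝ} (hκ : κ < 1)
    (h : d ∈ modulusRatioAt κ ⟨a, 0, ha⟩) : d ⟨a, 0, ha⟩ 0 0 = 0 :=
  entry_eq_zero_of_modulusRatio_fin_one (M := d ⟨a, 0, ha⟩) hκ h

/-- **PROVED — THE RECORDED REASON (RULING A324 (3)(c)): membership in the UNGUARDED `GaugeRatioClass τ`
(`τ < 1`; no sign hypothesis on `τ` needed) forces `(d ⟨a, 0⟩) 0 0 = 0` at EVERY `a > 0`.** [folklore] -/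
theorem mem_gaugeRatioClass_N0 {d : Datum} {τ : ℝ} (hτ : τ < 1) (h : d ∈ GaugeRatioClass τ) (a : ℝ)
    (ha : 0 < a) : d ⟨a, 0, ha⟩ 0 0 = 0 :=
  entry_eq_zero_of_mem_gaugeRatioAt_N0 ha hτ (h ⟨a, 0, ha⟩)

/-- PROVED: the same for the unguarded `ModulusRatioClass κ` (`κ < 1`). [folklore] -/
theorem mem_modulusRatioClass_N0 {d : Datum} {κ : ℝ} (hκ : κ < 1) (h : d ∈ ModulusRatioClass κ) (a : ℝ)
    (ha : 0 < a) : d ⟨a, 0, ha⟩ 0 0 = 0 :=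
  entry_eq_zero_of_mem_modulusRatioAt_N0 ha hκ (h ⟨a, 0, ha⟩)

/-- PROVED: ONE non-zero degenerate entry bars a datum from the unguarded gauge class. [folklore] -/
theorem not_mem_gaugeRatioClass_of_entry_ne_zero {d : Datum} {a : ℝ} (ha : 0 < a) (h0 : d ⟨a, 0, ha⟩ 0 0 ≠ 0)
    {τ : ℝ} (hτ : τ < 1) : d ∉ GaugeRatioClass τ :=
  fun h => h0 (mem_gaugeRatioClass_N0 hτ h a ha)

/-- PROVED: modulus twin. [folklore] -/
theorem not_mem_modulusRatioClass_of_entry_ne_zero {d : Datum} {a : ℝ} (ha : 0 < a) (h0 : d ⟨a, 0, ha⟩ 0 0 ≠ 0)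
    {κ : ℝ} (hκ : κ < 1) : d ∉ ModulusRatioClass κ :=
  fun h => h0 (mem_modulusRatioClass_N0 hκ h a ha)

/-- **PROVED — THE UNGUARDED ∀-WINDOW CELL IS EMPTY MODULO ONE SIGN**: if `(ζ ⟨a, 0⟩) 0 0 ≠ 0` at a single
`a > 0` (DATA at every served window: the diagonal entry `Q₀₀^ζ(a) > 0`; NOT proved here), then NO
`S ⊆ GaugeRatioClass τ` (`τ < 1`) separates `ζ` from anything — `S` does not contain `ζ`. [folklore] -/
theorem not_separates_of_subset_gaugeRatioClass_of_entry_ne_zero {S D : Set Datum} {τ : ℝ}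
    (hS : S ⊆ GaugeRatioClass τ) (hτ : τ < 1) {a : ℝ} (ha : 0 < a) (h0 : zetaDatum ⟨a, 0, ha⟩ 0 0 ≠ 0) :
    ¬ Separates S D zetaDatum :=
  fun hsep => not_mem_gaugeRatioClass_of_entry_ne_zero ha h0 hτ (hS hsep.1)

/-- PROVED: modulus twin. [folklore] -/
theorem not_separates_of_subset_modulusRatioClass_of_entry_ne_zero {S D : Set Datum} {κ : ℝ}
    (hS : S ⊆ ModulusRatioClass κ) (hκ : κ < 1) {a : ℝ} (ha : 0 < a) (h0 : zetaDatum ⟨a, 0, ha⟩ 0 0 ≠ 0) :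
    ¬ Separates S D zetaDatum :=
  fun hsep => not_mem_modulusRatioClass_of_entry_ne_zero ha h0 hκ (hS hsep.1)

/-! ## §2 The GUARDED ∀-window classes (windows of dimension ≥ 2 only) -/

/-- the GUARDED ∀-window gauge-ratio class: `|ε₁| ≤ τ(ε₂ − ε₁)` at every window with `0 < N` (RULING A324
(3)(a)). [folklore] -/
def GaugeRatioClassPos (τ : ℝ) : Set Datum := {d | ∀ win : Window, 0 < win.N → d ∈ gaugeRatioAt τ win}

/-- the GUARDED ∀-window modulus-ratio class: `|ε₁| ≤ κ|ε₂|` at every window with `0 < N`. [folklore] -/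
def ModulusRatioClassPos (κ : ℝ) : Set Datum := {d | ∀ win : Window, 0 < win.N → d ∈ modulusRatioAt κ win}

/-- PROVED: the unguarded class lies inside the guarded one (so every guarded EXCLUSION below is stronger than its
unguarded predecessor, and every guarded PREMISE weaker). [folklore] -/
theorem gaugeRatioClass_subset_pos (τ : ℝ) : GaugeRatioClass τ ⊆ GaugeRatioClassPos τ :=
  fun _ h win _ => h win

/-- PROVED: modulus twin. [folklore] -/
theorem modulusRatioClass_subset_pos (κ : ℝ) : ModulusRatioClass κ ⊆ ModulusRatioClassPos κ :=
  fun _ h win _ => h win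

/-- PROVED: the guarded class projects into every single guarded window class. [folklore] -/
theorem gaugeRatioClassPos_subset {τ : ℝ} {win : Window} (hN : 0 < win.N) :
    GaugeRatioClassPos τ ⊆ gaugeRatioAt τ win := fun _ h => h win hN

/-- PROVED: modulus twin. [folklore] -/
theorem modulusRatioClassPos_subset {κ : ℝ} {win : Window} (hN : 0 < win.N) :
    ModulusRatioClassPos κ ⊆ modulusRatioAt κ win := fun _ h => h win hN

end Summit.RiemannHypothesis.RiemannHypothesis.Theorems.PfPersistence

end
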